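import Summits.CriticalPhenomena.PercolationContinuityZ3.Theorems.PercNearOneGluingNoHeavyLowerTailCubicThreePointTerminalClosure
import Mathlib.Tactic.Ring
import Mathlib.Tactic.Linarith
import Mathlib.Tactic.Positivity
import HarnessLib

/-!
# `NoHeavyLowerTail` (stmt-CriticalPhenomena-4575) — PARALLEL COMPOSITION of two dense-type three-point laws keeps `Ha ≥ 0`
# (the K3-semigroup property of the sharp cubic form `Hmax3`, dense × dense case; exact integer certificate)

Support file (prover prim-gen-kcluster gen 9, k-cluster line; `--supports stmt-CriticalPhenomena-4575`).  Pure real algebra, no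
definitions, no named facts, no sorries.  Cell convention and the forms `AG`, `Ha = t·AG − e₃`, `Hb = q·AG − e₃` of
`…CubicThreePointTerminalClosure` (`CubicThreePointTerminal.*`): `(q,u₁,u₂,u₃,t) = (P(a|b|c), P(ab|c), P(ac|b), P(bc|a), P(abc))`.

PARALLEL COMPOSITION.  If two 3-terminal systems with laws `x = (q,u,t)` and `y = (Q,v,T)` on disjoint edge sets are glued at the
three terminals (abstractly: two independent up-set 3-sunflower systems, partition = JOIN of the two partitions in the partition
lattice `M₃`), the composite law `z = x ⊔ y` is bilinear in `(x, y)`: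
  `z_q = qQ`,  `z_i = q vᵢ + uᵢ Q + uᵢ vᵢ` (`i = 1,2,3`),  `z_t = t·σ(y) + T·σ(x) − tT + Σ_{i≠j} uᵢ vⱼ`   (`σ` = total mass)
(equivalently `(z_q, z_q + z_i) = (qQ, (q+uᵢ)(Q+vᵢ))`: the "all separated" and "terminal `i` isolated" masses multiply).

THEOREM (`Ha_join_dense_dense`).  If both factors are DENSE-TYPE — cells `≥ 0`, `AG ≥ 0`, `Ha ≥ 0` and `t ≥ q` (for a point of
`{AG ≥ 0, max(Ha,Hb) ≥ 0}` the last two say `Hb ≤ Ha`, i.e. the law is a diluted star rather than a clamped triangle, memo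
KCLUSTER-gen9.md §3) — then `Ha(z) ≥ 0`.  Proof: the integer Positivstellensatz-type identity
  `24·Ha(z) = Σ_k c_k · m_k(x) · m'_k(y)`,  `c_k ∈ ℕ`,  each `m_k`, `m'_k` a product of cells and of the generators `AG`, `Ha`, `t − q`
(353 terms; found by an LP over the `S₃ × ℤ₂`-symmetrised products of the cubic generators and rationalised exactly —
run/shared/lean/prim/prim-gen-kcluster/code/gen9/num/jcert_gen.py, certificate cert_J.json), verified here by `ring`, after which every
term is nonnegative (`positivity`).  The generator `t − q` IS needed (without it the LP is infeasible), `−Hb` is not.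
With `…CubicThreePointJoinClosure` (`AG`, `Hb` under `⊔`, and the dense × sparse case) this yields the K3-SEMIGROUP THEOREM:
`{cells ≥ 0, AG ≥ 0, Hmax3 ≥ 0}` is closed under parallel composition and, by the duality `q ↔ t`, under the dual (meet) composition —
hence the sharp cubic row `Hmax3 = max(q,t)·AG − e₃ ≥ 0` (⇒ `H_{q+t}` ⇒ AG⁺ ⇒ SHK3⁺) holds on the whole series–parallel (join/meet) algebra
of 3-sunflower systems generated by two-point laws: stars, triangles, `K₄`, `K_{2,3}`, stars of blobs of stars, … (strictly larger than
the E/T-constructible class of THEOREM A).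
[cite: Gladkov2024StrongFKG, Cor. 4.2 (the quadratic form AG)]; [cite: GladkovZimin2024HK, §4 (one-coordinate decomposition)]
-/

namespace Summit.CriticalPhenomena.PercolationContinuityZ3.Theorems

namespace CubicThreePointJoin

open CubicThreePointTerminal

set_option maxHeartbeats 4000000 in
/-- **Dense × dense.**  For two dense-type laws `x = (q,u,t)`, `y = (Q,v,T)` (cells `≥ 0`, `AG ≥ 0`, `Ha ≥ 0`, `t ≥ q`) the parallel
composition `z` (`z_q = qQ`, `z_i = q vᵢ + uᵢ Q + uᵢ vᵢ`, `z_t = tσ(y) + Tσ(x) − tT + Σ_{i≠j} uᵢvⱼ`) has `Ha(z) ≥ 0`: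
`24·Ha(z)` is an explicit nonnegative integer combination of products of the generators. [folklore] -/
theorem Ha_join_dense_dense {q u₁ u₂ u₃ t Q v₁ v₂ v₃ T zq z₁ z₂ z₃ zt : ℝ}
    (hq : 0 ≤ q) (hu₁ : 0 ≤ u₁) (hu₂ : 0 ≤ u₂) (hu₃ : 0 ≤ u₃) (ht : 0 ≤ t)
    (hQ : 0 ≤ Q) (hv₁ : 0 ≤ v₁) (hv₂ : 0 ≤ v₂) (hv₃ : 0 ≤ v₃) (hT : 0 ≤ T)
    (hagx : 0 ≤ AG q u₁ u₂ u₃ t) (hagy : 0 ≤ AG Q v₁ v₂ v₃ T) (hHax : 0 ≤ Ha q u₁ u₂ u₃ t) (hHay : 0 ≤ Ha Q v₁ v₂ v₃ T)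
    (htqx : 0 ≤ t - q) (htqy : 0 ≤ T - Q)
    (hzq : zq = q * Q) (hz₁ : z₁ = q * v₁ + u₁ * Q + u₁ * v₁) (hz₂ : z₂ = q * v₂ + u₂ * Q + u₂ * v₂)
    (hz₃ : z₃ = q * v₃ + u₃ * Q + u₃ * v₃)
    (hzt : zt = t * (Q + v₁ + v₂ + v₃ + T) + T * (q + u₁ + u₂ + u₃) + (u₁ * (v₂ + v₃) + u₂ * (v₁ + v₃) + u₃ * (v₁ + v₂))) :
    0 ≤ Ha zq z₁ z₂ z₃ zt := by
  have key : 24 * Ha zq z₁ z₂ z₃ zt =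
      (Ha q u₁ u₂ u₃ t) * (24 * (Q * Q * Q) + 24 * (Q * Q * v₁) + 24 * (Q * Q * v₂) + 24 * (Q * Q * v₃)
        + 6 * (v₁ * v₁ * v₂) + 6 * (v₁ * v₁ * v₃) + 6 * (v₂ * v₂ * v₁) + 6 * (v₂ * v₂ * v₃) + 6 * (v₃ * v₃ * v₁)
        + 6 * (v₃ * v₃ * v₂) + 12 * ((Ha Q v₁ v₂ v₃ T))) + q * q * q * (24 * ((Ha Q v₁ v₂ v₃ T)))
        + (AG q u₁ u₂ u₃ t) * u₁ * (24 * (Q * Q * v₂) + 24 * (Q * Q * v₃) + 24 * (Q * Q * T) + 24 * (Q * v₂ * v₂)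
        + 24 * (Q * v₃ * v₃) + 24 * (Q * v₁ * v₂) + 24 * (Q * v₁ * v₃) + 12 * (Q * v₂ * v₃) + 12 * (Q * v₃ * v₂)
        + 24 * (Q * v₁ * T) + 36 * (Q * v₂ * T) + 36 * (Q * v₃ * T) + 6 * (Q * T * T) + 12 * (v₂ * v₂ * v₁)
        + 12 * (v₃ * v₃ * v₁) + 3 * (v₁ * v₂ * v₃) + 3 * (v₁ * v₃ * v₂) + 18 * (v₁ * v₂ * T) + 18 * (v₁ * v₃ * T))
        + (AG q u₁ u₂ u₃ t) * u₂ * (24 * (Q * Q * v₁) + 24 * (Q * Q * v₃) + 24 * (Q * Q * T) + 24 * (Q * v₁ * v₁)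
        + 24 * (Q * v₃ * v₃) + 24 * (Q * v₂ * v₁) + 24 * (Q * v₂ * v₃) + 12 * (Q * v₁ * v₃) + 12 * (Q * v₃ * v₁)
        + 24 * (Q * v₂ * T) + 36 * (Q * v₁ * T) + 36 * (Q * v₃ * T) + 6 * (Q * T * T) + 12 * (v₁ * v₁ * v₂)
        + 12 * (v₃ * v₃ * v₂) + 3 * (v₂ * v₁ * v₃) + 3 * (v₂ * v₃ * v₁) + 18 * (v₂ * v₁ * T) + 18 * (v₂ * v₃ * T))
        + (AG q u₁ u₂ u₃ t) * u₃ * (24 * (Q * Q * v₁) + 24 * (Q * Q * v₂) + 24 * (Q * Q * T) + 24 * (Q * v₁ * v₁)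
        + 24 * (Q * v₂ * v₂) + 24 * (Q * v₃ * v₁) + 24 * (Q * v₃ * v₂) + 12 * (Q * v₁ * v₂) + 12 * (Q * v₂ * v₁)
        + 24 * (Q * v₃ * T) + 36 * (Q * v₁ * T) + 36 * (Q * v₂ * T) + 6 * (Q * T * T) + 12 * (v₁ * v₁ * v₃)
        + 12 * (v₂ * v₂ * v₃) + 3 * (v₃ * v₁ * v₂) + 3 * (v₃ * v₂ * v₁) + 18 * (v₃ * v₁ * T) + 18 * (v₃ * v₂ * T))
        + q * q * u₁ * (24 * ((AG Q v₁ v₂ v₃ T) * v₂) + 24 * ((AG Q v₁ v₂ v₃ T) * v₃) + 24 * ((AG Q v₁ v₂ v₃ T) * T)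
        + 24 * ((Ha Q v₁ v₂ v₃ T)) + 12 * ((T - Q) * v₂ * v₃) + 12 * ((T - Q) * v₃ * v₂))
        + q * q * u₂ * (24 * ((AG Q v₁ v₂ v₃ T) * v₁) + 24 * ((AG Q v₁ v₂ v₃ T) * v₃) + 24 * ((AG Q v₁ v₂ v₃ T) * T)
        + 24 * ((Ha Q v₁ v₂ v₃ T)) + 12 * ((T - Q) * v₁ * v₃) + 12 * ((T - Q) * v₃ * v₁))
        + q * q * u₃ * (24 * ((AG Q v₁ v₂ v₃ T) * v₁) + 24 * ((AG Q v₁ v₂ v₃ T) * v₂) + 24 * ((AG Q v₁ v₂ v₃ T) * T)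
        + 24 * ((Ha Q v₁ v₂ v₃ T)) + 12 * ((T - Q) * v₁ * v₂) + 12 * ((T - Q) * v₂ * v₁))
        + (AG q u₁ u₂ u₃ t) * t * (24 * (Q * Q * v₁) + 24 * (Q * Q * v₂) + 24 * (Q * Q * v₃) + 24 * (Q * Q * T)
        + 24 * (Q * v₁ * v₁) + 24 * (Q * v₂ * v₂) + 24 * (Q * v₃ * v₃) + 36 * (Q * v₁ * v₂) + 36 * (Q * v₁ * v₃)
        + 36 * (Q * v₂ * v₁) + 36 * (Q * v₂ * v₃) + 36 * (Q * v₃ * v₁) + 36 * (Q * v₃ * v₂) + 42 * (Q * v₁ * T)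
        + 42 * (Q * v₂ * T) + 42 * (Q * v₃ * T) + 6 * (Q * T * T) + 9 * (v₁ * v₂ * T) + 9 * (v₁ * v₃ * T)
        + 9 * (v₂ * v₁ * T) + 9 * (v₂ * v₃ * T) + 9 * (v₃ * v₁ * T) + 9 * (v₃ * v₂ * T))
        + (t - q) * u₁ * u₂ * (12 * (Q * Q * v₃) + 12 * (Q * v₁ * v₃)) + (t - q) * u₁ * u₃ * (12 * (Q * Q * v₂)
        + 12 * (Q * v₁ * v₂)) + (t - q) * u₂ * u₁ * (12 * (Q * Q * v₃) + 12 * (Q * v₂ * v₃))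
        + (t - q) * u₂ * u₃ * (12 * (Q * Q * v₁) + 12 * (Q * v₂ * v₁)) + (t - q) * u₃ * u₁ * (12 * (Q * Q * v₂)
        + 12 * (Q * v₃ * v₂)) + (t - q) * u₃ * u₂ * (12 * (Q * Q * v₁) + 12 * (Q * v₃ * v₁))
        + (AG q u₁ u₂ u₃ t) * q * (24 * (Q * Q * T) + 24 * (Q * v₁ * T) + 24 * (Q * v₂ * T) + 24 * (Q * v₃ * T)
        + 24 * (Q * T * T)) + q * q * t * (24 * ((AG Q v₁ v₂ v₃ T) * Q) + 24 * ((AG Q v₁ v₂ v₃ T) * v₁)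
        + 24 * ((AG Q v₁ v₂ v₃ T) * v₂) + 24 * ((AG Q v₁ v₂ v₃ T) * v₃) + 24 * ((AG Q v₁ v₂ v₃ T) * T))
        + q * u₁ * u₁ * (24 * (v₂ * v₂ * v₃) + 24 * (v₃ * v₃ * v₂) + 12 * (v₂ * v₃ * T) + 12 * (v₃ * v₂ * T)
        + 24 * ((AG Q v₁ v₂ v₃ T) * v₂) + 24 * ((AG Q v₁ v₂ v₃ T) * v₃) + 24 * ((AG Q v₁ v₂ v₃ T) * T))
        + q * u₂ * u₂ * (24 * (v₁ * v₁ * v₃) + 24 * (v₃ * v₃ * v₁) + 12 * (v₁ * v₃ * T) + 12 * (v₃ * v₁ * T)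
        + 24 * ((AG Q v₁ v₂ v₃ T) * v₁) + 24 * ((AG Q v₁ v₂ v₃ T) * v₃) + 24 * ((AG Q v₁ v₂ v₃ T) * T))
        + q * u₃ * u₃ * (24 * (v₁ * v₁ * v₂) + 24 * (v₂ * v₂ * v₁) + 12 * (v₁ * v₂ * T) + 12 * (v₂ * v₁ * T)
        + 24 * ((AG Q v₁ v₂ v₃ T) * v₁) + 24 * ((AG Q v₁ v₂ v₃ T) * v₂) + 24 * ((AG Q v₁ v₂ v₃ T) * T))
        + u₁ * u₁ * u₂ * (24 * (Q * v₃ * v₃) + 36 * (Q * v₃ * T) + 12 * (v₁ * v₃ * v₃) + 24 * (v₁ * v₃ * T)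
        + 6 * (v₂ * v₃ * T) + 12 * ((AG Q v₁ v₂ v₃ T) * v₂) + 6 * ((Ha Q v₁ v₂ v₃ T)))
        + u₁ * u₁ * u₃ * (24 * (Q * v₂ * v₂) + 36 * (Q * v₂ * T) + 12 * (v₁ * v₂ * v₂) + 24 * (v₁ * v₂ * T)
        + 6 * (v₃ * v₂ * T) + 12 * ((AG Q v₁ v₂ v₃ T) * v₃) + 6 * ((Ha Q v₁ v₂ v₃ T)))
        + u₂ * u₂ * u₁ * (24 * (Q * v₃ * v₃) + 36 * (Q * v₃ * T) + 12 * (v₂ * v₃ * v₃) + 24 * (v₂ * v₃ * T)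
        + 6 * (v₁ * v₃ * T) + 12 * ((AG Q v₁ v₂ v₃ T) * v₁) + 6 * ((Ha Q v₁ v₂ v₃ T)))
        + u₂ * u₂ * u₃ * (24 * (Q * v₁ * v₁) + 36 * (Q * v₁ * T) + 12 * (v₂ * v₁ * v₁) + 24 * (v₂ * v₁ * T)
        + 6 * (v₃ * v₁ * T) + 12 * ((AG Q v₁ v₂ v₃ T) * v₃) + 6 * ((Ha Q v₁ v₂ v₃ T)))
        + u₃ * u₃ * u₁ * (24 * (Q * v₂ * v₂) + 36 * (Q * v₂ * T) + 12 * (v₃ * v₂ * v₂) + 24 * (v₃ * v₂ * T)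
        + 6 * (v₁ * v₂ * T) + 12 * ((AG Q v₁ v₂ v₃ T) * v₁) + 6 * ((Ha Q v₁ v₂ v₃ T)))
        + u₃ * u₃ * u₂ * (24 * (Q * v₁ * v₁) + 36 * (Q * v₁ * T) + 12 * (v₃ * v₁ * v₁) + 24 * (v₃ * v₁ * T)
        + 6 * (v₂ * v₁ * T) + 12 * ((AG Q v₁ v₂ v₃ T) * v₂) + 6 * ((Ha Q v₁ v₂ v₃ T)))
        + u₁ * u₂ * t * (12 * (Q * v₃ * v₃) + 36 * (Q * v₁ * v₃) + 21 * (Q * v₃ * T) + 24 * (v₁ * v₁ * v₃)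
        + 6 * (v₃ * v₃ * v₁) + 24 * (v₁ * v₃ * T) + 18 * ((AG Q v₁ v₂ v₃ T) * v₁) + 9 * ((AG Q v₁ v₂ v₃ T) * T))
        + u₁ * u₃ * t * (12 * (Q * v₂ * v₂) + 36 * (Q * v₁ * v₂) + 21 * (Q * v₂ * T) + 24 * (v₁ * v₁ * v₂)
        + 6 * (v₂ * v₂ * v₁) + 24 * (v₁ * v₂ * T) + 18 * ((AG Q v₁ v₂ v₃ T) * v₁) + 9 * ((AG Q v₁ v₂ v₃ T) * T))
        + u₂ * u₁ * t * (12 * (Q * v₃ * v₃) + 36 * (Q * v₂ * v₃) + 21 * (Q * v₃ * T) + 24 * (v₂ * v₂ * v₃)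
        + 6 * (v₃ * v₃ * v₂) + 24 * (v₂ * v₃ * T) + 18 * ((AG Q v₁ v₂ v₃ T) * v₂) + 9 * ((AG Q v₁ v₂ v₃ T) * T))
        + u₂ * u₃ * t * (12 * (Q * v₁ * v₁) + 36 * (Q * v₂ * v₁) + 21 * (Q * v₁ * T) + 24 * (v₂ * v₂ * v₁)
        + 6 * (v₁ * v₁ * v₂) + 24 * (v₂ * v₁ * T) + 18 * ((AG Q v₁ v₂ v₃ T) * v₂) + 9 * ((AG Q v₁ v₂ v₃ T) * T))
        + u₃ * u₁ * t * (12 * (Q * v₂ * v₂) + 36 * (Q * v₃ * v₂) + 21 * (Q * v₂ * T) + 24 * (v₃ * v₃ * v₂)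
        + 6 * (v₂ * v₂ * v₃) + 24 * (v₃ * v₂ * T) + 18 * ((AG Q v₁ v₂ v₃ T) * v₃) + 9 * ((AG Q v₁ v₂ v₃ T) * T))
        + u₃ * u₂ * t * (12 * (Q * v₁ * v₁) + 36 * (Q * v₃ * v₁) + 21 * (Q * v₁ * T) + 24 * (v₃ * v₃ * v₁)
        + 6 * (v₁ * v₁ * v₃) + 24 * (v₃ * v₁ * T) + 18 * ((AG Q v₁ v₂ v₃ T) * v₃) + 9 * ((AG Q v₁ v₂ v₃ T) * T))
        + q * u₁ * t * (24 * (Q * v₂ * v₃) + 24 * (Q * v₃ * v₂) + 21 * (v₁ * v₂ * v₃) + 21 * (v₁ * v₃ * v₂)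
        + 36 * (v₂ * v₂ * v₃) + 36 * (v₃ * v₃ * v₂) + 21 * (v₂ * v₃ * T) + 21 * (v₃ * v₂ * T)
        + 24 * ((AG Q v₁ v₂ v₃ T) * Q) + 24 * ((AG Q v₁ v₂ v₃ T) * v₁) + 36 * ((AG Q v₁ v₂ v₃ T) * v₂)
        + 36 * ((AG Q v₁ v₂ v₃ T) * v₃) + 42 * ((AG Q v₁ v₂ v₃ T) * T)) + q * u₁ * u₂ * (24 * (Q * v₃ * T)
        + 36 * (v₁ * v₃ * T) + 24 * ((AG Q v₁ v₂ v₃ T) * v₁) + 12 * ((AG Q v₁ v₂ v₃ T) * v₃)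
        + 36 * ((AG Q v₁ v₂ v₃ T) * T) + 12 * ((T - Q) * v₁ * v₃)) + q * u₁ * u₃ * (24 * (Q * v₂ * T)
        + 36 * (v₁ * v₂ * T) + 24 * ((AG Q v₁ v₂ v₃ T) * v₁) + 12 * ((AG Q v₁ v₂ v₃ T) * v₂)
        + 36 * ((AG Q v₁ v₂ v₃ T) * T) + 12 * ((T - Q) * v₁ * v₂)) + q * u₂ * t * (24 * (Q * v₁ * v₃)
        + 24 * (Q * v₃ * v₁) + 21 * (v₂ * v₁ * v₃) + 21 * (v₂ * v₃ * v₁) + 36 * (v₁ * v₁ * v₃) + 36 * (v₃ * v₃ * v₁)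
        + 21 * (v₁ * v₃ * T) + 21 * (v₃ * v₁ * T) + 24 * ((AG Q v₁ v₂ v₃ T) * Q) + 24 * ((AG Q v₁ v₂ v₃ T) * v₂)
        + 36 * ((AG Q v₁ v₂ v₃ T) * v₁) + 36 * ((AG Q v₁ v₂ v₃ T) * v₃) + 42 * ((AG Q v₁ v₂ v₃ T) * T))
        + q * u₂ * u₁ * (24 * (Q * v₃ * T) + 36 * (v₂ * v₃ * T) + 24 * ((AG Q v₁ v₂ v₃ T) * v₂)
        + 12 * ((AG Q v₁ v₂ v₃ T) * v₃) + 36 * ((AG Q v₁ v₂ v₃ T) * T) + 12 * ((T - Q) * v₂ * v₃))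
        + q * u₂ * u₃ * (24 * (Q * v₁ * T) + 36 * (v₂ * v₁ * T) + 24 * ((AG Q v₁ v₂ v₃ T) * v₂)
        + 12 * ((AG Q v₁ v₂ v₃ T) * v₁) + 36 * ((AG Q v₁ v₂ v₃ T) * T) + 12 * ((T - Q) * v₂ * v₁))
        + q * u₃ * t * (24 * (Q * v₁ * v₂) + 24 * (Q * v₂ * v₁) + 21 * (v₃ * v₁ * v₂) + 21 * (v₃ * v₂ * v₁)
        + 36 * (v₁ * v₁ * v₂) + 36 * (v₂ * v₂ * v₁) + 21 * (v₁ * v₂ * T) + 21 * (v₂ * v₁ * T)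
        + 24 * ((AG Q v₁ v₂ v₃ T) * Q) + 24 * ((AG Q v₁ v₂ v₃ T) * v₃) + 36 * ((AG Q v₁ v₂ v₃ T) * v₁)
        + 36 * ((AG Q v₁ v₂ v₃ T) * v₂) + 42 * ((AG Q v₁ v₂ v₃ T) * T)) + q * u₃ * u₁ * (24 * (Q * v₂ * T)
        + 36 * (v₃ * v₂ * T) + 24 * ((AG Q v₁ v₂ v₃ T) * v₃) + 12 * ((AG Q v₁ v₂ v₃ T) * v₂)
        + 36 * ((AG Q v₁ v₂ v₃ T) * T) + 12 * ((T - Q) * v₃ * v₂)) + q * u₃ * u₂ * (24 * (Q * v₁ * T)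
        + 36 * (v₃ * v₁ * T) + 24 * ((AG Q v₁ v₂ v₃ T) * v₃) + 12 * ((AG Q v₁ v₂ v₃ T) * v₁)
        + 36 * ((AG Q v₁ v₂ v₃ T) * T) + 12 * ((T - Q) * v₃ * v₁)) + u₁ * u₂ * u₃ * (21 * (Q * v₁ * T)
        + 5 * (Q * T * T) + 3 * ((AG Q v₁ v₂ v₃ T) * v₁)) + u₁ * u₃ * u₂ * (21 * (Q * v₁ * T) + 5 * (Q * T * T)
        + 3 * ((AG Q v₁ v₂ v₃ T) * v₁)) + u₂ * u₁ * u₃ * (21 * (Q * v₂ * T) + 5 * (Q * T * T)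
        + 3 * ((AG Q v₁ v₂ v₃ T) * v₂)) + u₂ * u₃ * u₁ * (21 * (Q * v₂ * T) + 5 * (Q * T * T)
        + 3 * ((AG Q v₁ v₂ v₃ T) * v₂)) + u₃ * u₁ * u₂ * (21 * (Q * v₃ * T) + 5 * (Q * T * T)
        + 3 * ((AG Q v₁ v₂ v₃ T) * v₃)) + u₃ * u₂ * u₁ * (21 * (Q * v₃ * T) + 5 * (Q * T * T)
        + 3 * ((AG Q v₁ v₂ v₃ T) * v₃)) + q * t * t * (5 * (v₁ * v₂ * v₃) + 5 * (v₁ * v₃ * v₂) + 5 * (v₂ * v₁ * v₃)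
        + 5 * (v₂ * v₃ * v₁) + 5 * (v₃ * v₁ * v₂) + 5 * (v₃ * v₂ * v₁) + 24 * ((AG Q v₁ v₂ v₃ T) * Q)
        + 6 * ((AG Q v₁ v₂ v₃ T) * v₁) + 6 * ((AG Q v₁ v₂ v₃ T) * v₂) + 6 * ((AG Q v₁ v₂ v₃ T) * v₃)
        + 6 * ((AG Q v₁ v₂ v₃ T) * T)) + u₁ * u₂ * u₂ * (12 * (v₁ * v₁ * v₃)) + u₁ * u₃ * u₃ * (12 * (v₁ * v₁ * v₂))
        + u₂ * u₁ * u₁ * (12 * (v₂ * v₂ * v₃)) + u₂ * u₃ * u₃ * (12 * (v₂ * v₂ * v₁))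
        + u₃ * u₁ * u₁ * (12 * (v₃ * v₃ * v₂)) + u₃ * u₂ * u₂ * (12 * (v₃ * v₃ * v₁)) := by
    subst hzq hz₁ hz₂ hz₃ hzt
    simp only [Ha, AG]
    ring
  have hR : 0 ≤ 24 * Ha zq z₁ z₂ z₃ zt := by
    rw [key]
    generalize AG q u₁ u₂ u₃ t = A at hagx ⊢
    generalize AG Q v₁ v₂ v₃ T = A' at hagy ⊢
    generalize Ha q u₁ u₂ u₃ t = H at hHax ⊢
    generalize Ha Q v₁ v₂ v₃ T = H' at hHay ⊢
    generalize t - q = D at htqx ⊢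
    generalize T - Q = D' at htqy ⊢
    positivity
  linarith

end CubicThreePointJoin

end Summit.CriticalPhenomena.PercolationContinuityZ3.Theorems
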